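import Literature.AlgebraicGeometry.Frobenioids.DirectSumPerfFactorial
import Literature.AlgebraicGeometry.Frobenioids.ArithmeticDivisors
import Literature.AlgebraicGeometry.Frobenioids.MonoidTransport
import HarnessLib

/-!
# Frobenioids I, Example 6.3: the monoid `Φ(L)` of effective arithmetic divisors is PERF-FACTORIAL

Mochizuki, *The geometry of Frobenioids I*, Kyushu J. Math. **62** (2008), Example 6.3, kurims p. 113:
"`Φ(L) := ⊕_{v ∈ V(L)} ord(O_v^▷)` … Thus [cf. §0], `Φ(L)` (`≠ 0`) is perf-factorial, … and there is a natural
bijection `Prime(Φ(L)) ≃ V(L)`" [cite: MochizukiFrdI2008, Ex. 6.3 p.113] — the input «`Φ` is perf-factorial»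
of Thm. 6.4 (i) p. 115 (sub-DAG row FrdI:Thm6.4(i)/T64i-L02) and of the realification `C^rlf` of the
arithmetic Frobenioid (Thm. 6.4 (ii)(iii); [IUTchI] Ex. 5.1 (vii) `†ℱ^⊛ℝ_mod`).

PROOF (our kernel check of a printed "cf. §0"): the tree's `EffArithDivisor L = (FinitePlace L →₀ ℕ) ×
(InfinitePlace L → ℝ_{≥0})` (`ArithmeticDivisors.lean`, seat abc-iut-L1-t3), written multiplicatively, is
isomorphic to the direct sum `⊕_{v ∈ V(L)} Λ_v` with `Λ_v = ℝ_{≥0}` at the (finitely many) infinite places and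
`Λ_v = ℤ_{≥0}` at the finite places (`effArithDivisorEquiv`), a direct sum of MONOPRIME monoids, hence
perf-factorial by `DirectSum.isPerfFactorial` (`DirectSumPerfFactorial.lean`); perf-factoriality transports
along the isomorphism (Def. 2.4 (i) is isomorphism-invariant: `MonoidTransport`, `FactorizationTransport`).
Divisoriality alone is abc-iut-L6-t10's `EffArithDivisor.isDivisorial` (`ArithmeticFrobenioidHypotheses.lean`).
Seat abc-iut-L1-d2 (cell abc-iut); sub-DAG row FrdI:Thm6.4(i)/T64i-L02 «Thm64i_L02_perfFactorial».
-/

noncomputable section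

namespace Literature.AlgebraicGeometry.Frobenioids

open Function NumberField Literature.AnabelianGeometry.EtaleTheta

universe u

/-! ### The monoprime coefficient monoids `Λ_v` at the places -/

/-- `ℤ_{≥0}` (multiplicatively `Multiplicative ℕ`) is monoprime. [cite: MochizukiFrdI2008, §0 p.10] -/
theorem isMonoprime_multiplicative_nat : IsMonoprime (Multiplicative ℕ) :=
  IsMonoprime.ofZ ⟨⟨MulEquiv.refl _⟩⟩

/-- `ℝ_{≥0}` (multiplicatively `Multiplicative ℝ≥0`) is monoprime. [cite: MochizukiFrdI2008, §0 p.10] -/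
theorem isMonoprime_multiplicative_nnreal : IsMonoprime (Multiplicative NNReal) :=
  IsMonoprime.ofR ⟨⟨MulEquiv.refl _⟩⟩

variable (L : Type u) [Field L] [NumberField L]

/-- The coefficient monoid `ord(O_v^▷)` of `Φ(L)` at a place `v ∈ V(L)` (Ex. 6.3 p. 113): `≅ ℝ_{≥0}` at an
archimedean place, `≅ ℤ_{≥0}` at a nonarchimedean place (multiplicative rendering), indexed by the tree's
`Places L = InfinitePlace L ⊕ FinitePlace L`. [cite: MochizukiFrdI2008, Ex. 6.3 p.113] -/
def PlaceCoeff : Places L → Type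
  | .inl _ => Multiplicative NNReal
  | .inr _ => Multiplicative ℕ

/-- Each `ord(O_v^▷)` is a commutative monoid. [cite: MochizukiFrdI2008, Ex. 6.3 p.113] -/
instance instCommMonoidPlaceCoeff : ∀ v : Places L, CommMonoid (PlaceCoeff L v)
  | .inl _ => inferInstanceAs (CommMonoid (Multiplicative NNReal))
  | .inr _ => inferInstanceAs (CommMonoid (Multiplicative ℕ))

/-- Each `ord(O_v^▷)` is monoprime ("`≅ ℤ_{≥0}` … `≅ ℝ_{≥0}`", Ex. 6.3 p. 112). [cite: MochizukiFrdI2008, Ex. 6.3 p.112] -/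
theorem isMonoprime_placeCoeff : ∀ v : Places L, IsMonoprime (PlaceCoeff L v)
  | .inl _ => isMonoprime_multiplicative_nnreal
  | .inr _ => isMonoprime_multiplicative_nat

/-! ### `Φ(L) ≅ ⊕_{v ∈ V(L)} ord(O_v^▷)` -/

/-- The family of coefficients of an effective arithmetic divisor. [cite: MochizukiFrdI2008, Ex. 6.3 p.113] -/
def coeffOf (d : EffArithDivisor L) : ∀ v : Places L, PlaceCoeff L v
  | .inl w => Multiplicative.ofAdd (d.2 w)
  | .inr v => Multiplicative.ofAdd (d.1 v)

/-- `coeffOf` at an infinite place. [cite: MochizukiFrdI2008, Ex. 6.3 p.113] -/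
@[simp] theorem coeffOf_inl (d : EffArithDivisor L) (w : InfinitePlace L) :
    coeffOf L d (.inl w) = Multiplicative.ofAdd (d.2 w) := rfl

/-- `coeffOf` at a finite place. [cite: MochizukiFrdI2008, Ex. 6.3 p.113] -/
@[simp] theorem coeffOf_inr (d : EffArithDivisor L) (v : FinitePlace L) :
    coeffOf L d (.inr v) = Multiplicative.ofAdd (d.1 v) := rfl

/-- `coeffOf` is additive-to-multiplicative. [cite: MochizukiFrdI2008, Ex. 6.3 p.113] -/
theorem coeffOf_add (d d' : EffArithDivisor L) : coeffOf L (d + d') = coeffOf L d * coeffOf L d' := by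
  funext v
  cases v with
  | inl w => rfl
  | inr v =>
    rw [Pi.mul_apply, coeffOf_inr, coeffOf_inr, coeffOf_inr, Prod.fst_add, Finsupp.add_apply, ofAdd_add]
    rfl

/-- `coeffOf 0 = 1`. [cite: MochizukiFrdI2008, Ex. 6.3 p.113] -/
theorem coeffOf_zero : coeffOf L 0 = 1 := by
  funext v
  cases v with
  | inl w => rfl
  | inr v => rfl

/-- The coefficient family of an effective arithmetic divisor is finitely supported (finitely many infinite
places; a `Finsupp` at the finite places). [cite: MochizukiFrdI2008, Ex. 6.3 p.113] -/
theorem dsupp_coeffOf_finite (d : EffArithDivisor L) : (dsupp (coeffOf L d)).Finite := by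
  refine ((Set.finite_range Sum.inl).union (d.1.support.finite_toSet.image Sum.inr)).subset ?_
  rintro (w | v) hv
  · exact Or.inl ⟨w, rfl⟩
  · refine Or.inr ⟨v, ?_, rfl⟩
    rw [Finset.mem_coe, Finsupp.mem_support_iff]
    intro h0
    apply hv
    rw [coeffOf_inr, h0, ofAdd_zero]
    rfl

/-- `Φ(L) → ⊕_v ord(O_v^▷)`, `d ↦ (d_v)_v`, a homomorphism. [cite: MochizukiFrdI2008, Ex. 6.3 p.113] -/
def toDirectSum : Multiplicative (EffArithDivisor L) →* directSum (PlaceCoeff L) where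
  toFun D := ⟨coeffOf L (Multiplicative.toAdd D), dsupp_coeffOf_finite L _⟩
  map_one' := Subtype.ext (by
    show coeffOf L (Multiplicative.toAdd 1) = 1
    rw [toAdd_one, coeffOf_zero])
  map_mul' D D' := Subtype.ext (by
    show coeffOf L (Multiplicative.toAdd (D * D')) = coeffOf L (Multiplicative.toAdd D) * coeffOf L (Multiplicative.toAdd D')
    rw [toAdd_mul, coeffOf_add])

/-- Components of `toDirectSum`. [cite: MochizukiFrdI2008, Ex. 6.3 p.113] -/
@[simp] theorem coe_toDirectSum (D : Multiplicative (EffArithDivisor L)) :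
    ((toDirectSum L D : directSum (PlaceCoeff L)) : ∀ v, PlaceCoeff L v) = coeffOf L (Multiplicative.toAdd D) := rfl

/-- `toDirectSum` is injective (a divisor is determined by its coefficients). [cite: MochizukiFrdI2008, Ex. 6.3 p.113] -/
theorem toDirectSum_injective : Injective (toDirectSum L) := by
  intro D D' h
  have hc : coeffOf L (Multiplicative.toAdd D) = coeffOf L (Multiplicative.toAdd D') :=
    congrArg (fun z : directSum (PlaceCoeff L) => (z : ∀ v, PlaceCoeff L v)) h
  apply Multiplicative.toAdd.injective
  refine Prod.ext (Finsupp.ext fun v => ?_) (funext fun w => ?_)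
  · exact Multiplicative.ofAdd.injective (by
      have := congrFun hc (.inr v); rwa [coeffOf_inr, coeffOf_inr] at this)
  · exact Multiplicative.ofAdd.injective (by
      have := congrFun hc (.inl w); rwa [coeffOf_inl, coeffOf_inl] at this)

/-- `toDirectSum` is surjective (finite support at the finite places gives a `Finsupp`).
[cite: MochizukiFrdI2008, Ex. 6.3 p.113] -/
theorem toDirectSum_surjective : Surjective (toDirectSum L) := by
  intro f
  let g : FinitePlace L → ℕ := fun v => Multiplicative.toAdd ((f : ∀ v, PlaceCoeff L v) (.inr v))
  let g' : InfinitePlace L → NNReal := fun w => Multiplicative.toAdd ((f : ∀ v, PlaceCoeff L v) (.inl w))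
  have hfin : (Function.support g).Finite := by
    refine ((DirectSum.finite_dsupp f).preimage Sum.inr_injective.injOn).subset fun v hv => ?_
    rw [Set.mem_preimage, mem_dsupp_iff]
    intro h1
    apply hv
    show Multiplicative.toAdd ((f : ∀ v, PlaceCoeff L v) (.inr v)) = (0 : ℕ)
    rw [h1]
    rfl
  refine ⟨Multiplicative.ofAdd (Finsupp.ofSupportFinite g hfin, g'), ?_⟩
  apply Subtype.ext
  funext v
  rw [coe_toDirectSum, toAdd_ofAdd]
  cases v with
  | inl w => rfl
  | inr v => rw [coeffOf_inr, Finsupp.ofSupportFinite_coe]; rfl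

/-- **`Φ(L) ≅ ⊕_{v ∈ V(L)} ord(O_v^▷)`** (multiplicatively): the monoid of effective arithmetic divisors is the
direct sum of its monoprime coefficient monoids. [cite: MochizukiFrdI2008, Ex. 6.3 p.113] -/
def effArithDivisorEquiv : Multiplicative (EffArithDivisor L) ≃* directSum (PlaceCoeff L) :=
  MulEquiv.ofBijective (toDirectSum L) ⟨toDirectSum_injective L, toDirectSum_surjective L⟩

/-! ### `Φ(L)` is perf-factorial -/

namespace EffArithDivisor

/-- **Example 6.3 (p. 113): "Thus [cf. §0], `Φ(L)` (`≠ 0`) is perf-factorial"** — PROVED: `Φ(L) ≅ ⊕_v Λ_v`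
with every `Λ_v` monoprime, a direct sum of monoprime monoids is perf-factorial
(`DirectSum.isPerfFactorial`), and Def. 2.4 (i) transports along the isomorphism (divisoriality and the
monoprime `Φ(L)_𝔭` by `MonoidTransport`, conditions (c)(d) by `Factorization.Cond.of_mulEquiv` on `Φ(L)^pf`).
[cite: MochizukiFrdI2008, Ex. 6.3 p.113] -/
theorem isPerfFactorial : IsPerfFactorial (Multiplicative (EffArithDivisor L)) := by
  classical
  have h : IsPerfFactorial (directSum (PlaceCoeff L)) := DirectSum.isPerfFactorial (isMonoprime_placeCoeff L)
  let e := (effArithDivisorEquiv L).symm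
  refine IsPerfFactorial.of_cond (h.isDivisorial.of_mulEquiv e) (fun 𝔭' => ?_)
    (Factorization.Cond.of_mulEquiv (Perfection.congr e) h.cond)
  exact (h.isMonoprime (Primes.congr e.symm 𝔭')).of_mulEquiv
    (Primes.submonoidCongr e (Primes.congr e.symm 𝔭') 𝔭' (Primes.congr_apply_congr_symm e 𝔭'))

/-- The same for every number field in a family (the form `∀ L, IsPerfFactorial Φ(L)` of the sub-DAG row
T64i-L02 over the objects `Spec L` of `D = B(Gal(K/F))⁰`). [cite: MochizukiFrdI2008, Thm. 6.4 (i) p.115] -/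
theorem isPerfFactorial_forall :
    ∀ (L' : Type u) [Field L'] [NumberField L'], IsPerfFactorial (Multiplicative (EffArithDivisor L')) :=
  fun L' _ _ => isPerfFactorial L'

end EffArithDivisor

end Literature.AlgebraicGeometry.Frobenioids
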